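import Summits.MatrixMultiplication.MatrixMultiplication.Theorems.SoloInformedValMixedImages

/-!
# Hub pairs and the pure hub statement: a reduction to additive combinatorics

Solo-informed MatrixMultiplication, gen 81 (dossier `paper/val-superlinear.md` §15.8 (n)(x); CLAIMS c582, c587); a
sequel to `SoloInformedValMixedImages`.

A HUB PAIR is an accidental-free union of two complete blocks `X₁ × Y₁ × Z₁`, `X₂ × Y₂ × Z₂` (identity potentials in
an abelian group `G`, pair graphs `blockPairs`) with `Y₁ ∩ Y₂ = ∅ = Z₁ ∩ Z₂` and a common row `h ∈ X₁ ∩ X₂`.  The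
conjectured bound `|X₁||Y₁||Z₁| + |X₂||Y₂||Z₂| ≤ |G|` for hub pairs (proved in `SoloInformedValTwoRowHubPair` when a
block has two rows, and in `SoloInformedValHubPairFaces` when a two-row block has another side `≤ 2`) is reduced here
to a statement of pure additive combinatorics about two pairs of finite sets, the PURE HUB STATEMENT
(`PureHubStatement`):

  for `A = A₁ ⊔ A₂`, `Y = Y₁ ⊔ Y₂` with `A_s + Y_s` uniquely represented (`|A_s + Y_s| = |A_s||Y_s|`),
  `(A₁ + Y_u) ∩ (A₂ + Y_u) = ∅` (`u = 1, 2`) and HUB ELEMENTS `a₁° ∈ A₁`, `a₂° ∈ A₂` with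
  `(a₁° + Y₁) ∩ (A + Y₂) = ∅ = (a₂° + Y₂) ∩ (A + Y₁)`, one has `|A₁||Y₁| + |A₂||Y₂| ≤ |A + Y|`.

`PureHubStatement G` is a CONJECTURE (seat claim c587: no counterexample among 4.4·10⁶ random instances, 5·10⁴
hill-climbed instances beyond its trivial regime, and all instances in `ℤ_n`, `n ≤ 10`); this file does not prove
it.  What is proved (`NoAccidental.volume_add_volume_le_card_of_pureHub`,
`NoAccidental.card_triangleSet_le_card_of_pureHub`): for a hub pair the difference images `A_s = X_s - Z_s`
(`diffImage`) and the classes `Y_s` satisfy every hypothesis of the pure hub statement — `|A_s| = |X_s||Z_s|`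
(`NoAccidental.card_diffImage`), `A₁ ∩ A₂ = ∅` (`NoAccidental.disjoint_diffImage`), `A_s + Y_s = X_s + Y_s - Z_s`
is the block's image (`diffImage_add`, so unique representation is `NoAccidental.card_mixedImage_block`), the two
cross-disjointness conditions are the mixed-image disjointness `M_111 ∩ M_212 = ∅` of
`SoloInformedValMixedImages` and its block-swapped form, and `h - z₁`, `h - z₂` are hub elements
(`NoAccidental.disjoint_hub_translate₁/₂`: a coincidence `(h - z₁) + y₁ = (x' - z') + y₂` is the accidental
solution `(h - y₂) + (y₁ - z₁) + (z' - x') = 0`, available exactly because the hub row is adjacent to BOTH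
`J`-classes) — hence `PureHubStatement G` implies `|X₁||Y₁||Z₁| + |X₂||Y₂||Z₂| ≤ |A + Y| ≤ |G|` for every hub pair
with non-empty `Y`- and `Z`-classes.  No `sorry`.
-/

namespace Summit.MatrixMultiplication.MatrixMultiplication.Theorems.SoloVal

open Finset Pointwise

section PureHub

variable {G : Type*} [AddCommGroup G] [DecidableEq G]
variable {X₁ Y₁ Z₁ X₂ Y₂ Z₂ : Finset G}

/-- THE PURE HUB STATEMENT for the group `G` (conjectured, CLAIMS c587): two pairs of finite sets `A₁, Y₁` and
`A₂, Y₂` with uniquely represented sums, cross-disjoint translates and one hub element on each side satisfy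
`|A₁||Y₁| + |A₂||Y₂| ≤ |(A₁ ∪ A₂) + (Y₁ ∪ Y₂)|`. -/
def PureHubStatement (G : Type*) [AddCommGroup G] [DecidableEq G] : Prop :=
  ∀ A₁ A₂ Y₁ Y₂ : Finset G, Disjoint A₁ A₂ → Disjoint Y₁ Y₂ →
    (A₁ + Y₁).card = A₁.card * Y₁.card → (A₂ + Y₂).card = A₂.card * Y₂.card →
    Disjoint (A₁ + Y₁) (A₂ + Y₁) → Disjoint (A₁ + Y₂) (A₂ + Y₂) →
    (∃ a ∈ A₁, Disjoint ({a} + Y₁) ((A₁ ∪ A₂) + Y₂)) →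
    (∃ a ∈ A₂, Disjoint ({a} + Y₂) ((A₁ ∪ A₂) + Y₁)) →
    A₁.card * Y₁.card + A₂.card * Y₂.card ≤ ((A₁ ∪ A₂) + (Y₁ ∪ Y₂)).card

/-- The difference image `{x - z : x ∈ X, z ∈ Z}`. -/
def diffImage (X Z : Finset G) : Finset G :=
  (X ×ˢ Z).image (fun p => p.1 - p.2)

/-- Membership in a difference image. -/
theorem mem_diffImage {X Z : Finset G} {g : G} :
    g ∈ diffImage X Z ↔ ∃ x ∈ X, ∃ z ∈ Z, x - z = g := by
  unfold diffImage
  constructor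
  · intro hg
    obtain ⟨⟨x, z⟩, hm, he⟩ := Finset.mem_image.mp hg
    rw [Finset.mem_product] at hm
    exact ⟨x, hm.1, z, hm.2, he⟩
  · rintro ⟨x, hx, z, hz, he⟩
    exact Finset.mem_image.mpr ⟨(x, z), Finset.mem_product.mpr ⟨hx, hz⟩, he⟩

/-- `(X - Z) + Y = X + Y - Z`: the sumset of the difference image with `Y` is the block's mixed image. -/
theorem diffImage_add (X Y Z : Finset G) : diffImage X Z + Y = mixedImage X Y Z := by
  ext g
  rw [Finset.mem_add, mem_mixedImage]
  constructor
  · rintro ⟨a, ha, y, hy, rfl⟩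
    obtain ⟨x, hx, z, hz, rfl⟩ := mem_diffImage.mp ha
    exact ⟨x, hx, y, hy, z, hz, by abel⟩
  · rintro ⟨x, hx, y, hy, z, hz, rfl⟩
    exact ⟨x - z, mem_diffImage.mpr ⟨x, hx, z, hz, rfl⟩, y, hy, by abel⟩

/-- Accidental-freeness of the union is symmetric in the two blocks. -/
theorem NoAccidental.swap_blocks
    (hN : NoAccidental (id : G → G) id id (blockPairs X₁ Y₁ X₂ Y₂) (blockPairs Y₁ Z₁ Y₂ Z₂)
      (blockPairs Z₁ X₁ Z₂ X₂)) :
    NoAccidental (id : G → G) id id (blockPairs X₂ Y₂ X₁ Y₁) (blockPairs Y₂ Z₂ Y₁ Z₁)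
      (blockPairs Z₂ X₂ Z₁ X₁) := by
  rw [blockPairs_comm X₂, blockPairs_comm Y₂, blockPairs_comm Z₂]
  exact hN

/-- `|X₁ - Z₁| = |X₁||Z₁|`: a coincidence `x - z = x' - z'` inside a block is the accidental solution
`(x - y) + (y - z) + (z' - x') = 0` for any `y ∈ Y₁`. -/
theorem NoAccidental.card_diffImage (hY₁ : Y₁.Nonempty)
    (hN : NoAccidental (id : G → G) id id (blockPairs X₁ Y₁ X₂ Y₂) (blockPairs Y₁ Z₁ Y₂ Z₂)
      (blockPairs Z₁ X₁ Z₂ X₂)) :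
    (diffImage X₁ Z₁).card = X₁.card * Z₁.card := by
  obtain ⟨y, hy⟩ := hY₁
  have hinj : Set.InjOn (fun p : G × G => p.1 - p.2) ↑(X₁ ×ˢ Z₁) := by
    rintro ⟨x, z⟩ hm ⟨x', z'⟩ hm' heq
    simp only [Finset.coe_product, Set.mem_prod, Finset.mem_coe] at hm hm'
    have heq' : x - z = x' - z' := heq
    have h0 : (x - y) + (y - z) + (z' - x') = 0 :=
      calc (x - y) + (y - z) + (z' - x') = (x - z) - (x' - z') := by abel
        _ = 0 := by rw [heq', sub_self]
    obtain ⟨hx, -, hz⟩ := hN x y y z z' x' (mem_blockPairs.mpr (Or.inl ⟨hm.1, hy⟩))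
      (mem_blockPairs.mpr (Or.inl ⟨hy, hm.2⟩)) (mem_blockPairs.mpr (Or.inl ⟨hm'.2, hm'.1⟩)) h0
    rw [hx, hz]
  unfold diffImage
  rw [Finset.card_image_of_injOn hinj, Finset.card_product]

/-- `(X₁ - Z₁) ∩ (X₂ - Z₂) = ∅`: a coincidence `x₁ - z₁ = x₂ - z₂` is the accidental solution
`(x₁ - y) + (y - z₁) + (z₂ - x₂) = 0` (`y ∈ Y₁`), which would force `z₁ = z₂`. -/
theorem NoAccidental.disjoint_diffImage (hY₁ : Y₁.Nonempty) (hZ : Disjoint Z₁ Z₂)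
    (hN : NoAccidental (id : G → G) id id (blockPairs X₁ Y₁ X₂ Y₂) (blockPairs Y₁ Z₁ Y₂ Z₂)
      (blockPairs Z₁ X₁ Z₂ X₂)) :
    Disjoint (diffImage X₁ Z₁) (diffImage X₂ Z₂) := by
  obtain ⟨y, hy⟩ := hY₁
  rw [Finset.disjoint_left]
  intro g hg1 hg2
  obtain ⟨x₁, hx₁, z₁, hz₁, rfl⟩ := mem_diffImage.mp hg1
  obtain ⟨x₂, hx₂, z₂, hz₂, heq⟩ := mem_diffImage.mp hg2
  have h0 : (x₁ - y) + (y - z₁) + (z₂ - x₂) = 0 :=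
    calc (x₁ - y) + (y - z₁) + (z₂ - x₂) = (x₁ - z₁) - (x₂ - z₂) := by abel
      _ = 0 := by rw [heq, sub_self]
  have hc := hN x₁ y y z₁ z₂ x₂ (mem_blockPairs.mpr (Or.inl ⟨hx₁, hy⟩))
    (mem_blockPairs.mpr (Or.inl ⟨hy, hz₁⟩)) (mem_blockPairs.mpr (Or.inr ⟨hz₂, hx₂⟩)) h0
  exact Finset.disjoint_left.mp hZ hz₁ (hc.2.2.symm ▸ hz₂)

/-- Unique representation of `(X₁ - Z₁) + Y₁` (block 1 is a TPP block). -/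
theorem NoAccidental.card_diffImage_add (hY₁ : Y₁.Nonempty)
    (hN : NoAccidental (id : G → G) id id (blockPairs X₁ Y₁ X₂ Y₂) (blockPairs Y₁ Z₁ Y₂ Z₂)
      (blockPairs Z₁ X₁ Z₂ X₂)) :
    (diffImage X₁ Z₁ + Y₁).card = (diffImage X₁ Z₁).card * Y₁.card := by
  rw [diffImage_add, hN.card_mixedImage_block, hN.card_diffImage hY₁, Nat.mul_right_comm]

/-- Cross-disjointness for `Y₁`: `((X₁ - Z₁) + Y₁) ∩ ((X₂ - Z₂) + Y₁) = ∅`, i.e. `M_111 ∩ M_212 = ∅`. -/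
theorem NoAccidental.disjoint_diffImage_add₁ (hZ : Disjoint Z₁ Z₂)
    (hN : NoAccidental (id : G → G) id id (blockPairs X₁ Y₁ X₂ Y₂) (blockPairs Y₁ Z₁ Y₂ Z₂)
      (blockPairs Z₁ X₁ Z₂ X₂)) :
    Disjoint (diffImage X₁ Z₁ + Y₁) (diffImage X₂ Z₂ + Y₁) := by
  rw [diffImage_add, diffImage_add]
  exact hN.disjoint_mixedImage_111_212 hZ

/-- Cross-disjointness for `Y₂`: `((X₁ - Z₁) + Y₂) ∩ ((X₂ - Z₂) + Y₂) = ∅`, i.e. `M_121 ∩ M_222 = ∅` (the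
block-swapped form of `M_111 ∩ M_212 = ∅`). -/
theorem NoAccidental.disjoint_diffImage_add₂ (hZ : Disjoint Z₁ Z₂)
    (hN : NoAccidental (id : G → G) id id (blockPairs X₁ Y₁ X₂ Y₂) (blockPairs Y₁ Z₁ Y₂ Z₂)
      (blockPairs Z₁ X₁ Z₂ X₂)) :
    Disjoint (diffImage X₁ Z₁ + Y₂) (diffImage X₂ Z₂ + Y₂) := by
  rw [diffImage_add, diffImage_add]
  exact (hN.swap_blocks.disjoint_mixedImage_111_212 hZ.symm).symm

/-- `h - z₁` is a hub element: `((h - z₁) + Y₁) ∩ (A + Y₂) = ∅` for `A = (X₁ - Z₁) ∪ (X₂ - Z₂)`.  A coincidence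
`(h - z₁) + y₁ = (x' - z') + y₂` is the accidental solution `(h - y₂) + (y₁ - z₁) + (z' - x') = 0`, whose first
edge `(h, y₂)` exists because the hub row lies in `X₂`; it would force `y₁ = y₂`. -/
theorem NoAccidental.disjoint_hub_translate₁ {h z₁ : G} (hh₂ : h ∈ X₂) (hz₁ : z₁ ∈ Z₁)
    (hY : Disjoint Y₁ Y₂)
    (hN : NoAccidental (id : G → G) id id (blockPairs X₁ Y₁ X₂ Y₂) (blockPairs Y₁ Z₁ Y₂ Z₂)
      (blockPairs Z₁ X₁ Z₂ X₂)) :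
    Disjoint ({h - z₁} + Y₁) ((diffImage X₁ Z₁ ∪ diffImage X₂ Z₂) + Y₂) := by
  rw [Finset.disjoint_left]
  intro g hg1 hg2
  obtain ⟨a, ha, y₁, hy₁, rfl⟩ := Finset.mem_add.mp hg1
  rw [Finset.mem_singleton] at ha
  subst ha
  obtain ⟨a', ha', y₂, hy₂, heq⟩ := Finset.mem_add.mp hg2
  have hKI : ∃ x' z', (z', x') ∈ blockPairs Z₁ X₁ Z₂ X₂ ∧ x' - z' = a' := by
    rcases Finset.mem_union.mp ha' with h1 | h2
    · obtain ⟨x', hx', z', hz', he⟩ := mem_diffImage.mp h1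
      exact ⟨x', z', mem_blockPairs.mpr (Or.inl ⟨hz', hx'⟩), he⟩
    · obtain ⟨x', hx', z', hz', he⟩ := mem_diffImage.mp h2
      exact ⟨x', z', mem_blockPairs.mpr (Or.inr ⟨hz', hx'⟩), he⟩
  obtain ⟨x', z', hki, rfl⟩ := hKI
  have h0 : (h - y₂) + (y₁ - z₁) + (z' - x') = 0 :=
    calc (h - y₂) + (y₁ - z₁) + (z' - x') = (h - z₁ + y₁) - (x' - z' + y₂) := by abel
      _ = 0 := by rw [← heq, sub_self]
  have hc := hN h y₂ y₁ z₁ z' x' (mem_blockPairs.mpr (Or.inr ⟨hh₂, hy₂⟩))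
    (mem_blockPairs.mpr (Or.inl ⟨hy₁, hz₁⟩)) hki h0
  exact Finset.disjoint_left.mp hY hy₁ (hc.2.1 ▸ hy₂)

/-- `h - z₂` is a hub element on the other side: `((h - z₂) + Y₂) ∩ (A + Y₁) = ∅`; here the first edge `(h, y₁)`
of the accidental solution `(h - y₁) + (y₂ - z₂) + (z' - x') = 0` exists because the hub row lies in `X₁`. -/
theorem NoAccidental.disjoint_hub_translate₂ {h z₂ : G} (hh₁ : h ∈ X₁) (hz₂ : z₂ ∈ Z₂)
    (hY : Disjoint Y₁ Y₂)
    (hN : NoAccidental (id : G → G) id id (blockPairs X₁ Y₁ X₂ Y₂) (blockPairs Y₁ Z₁ Y₂ Z₂)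
      (blockPairs Z₁ X₁ Z₂ X₂)) :
    Disjoint ({h - z₂} + Y₂) ((diffImage X₁ Z₁ ∪ diffImage X₂ Z₂) + Y₁) := by
  rw [Finset.disjoint_left]
  intro g hg1 hg2
  obtain ⟨a, ha, y₂, hy₂, rfl⟩ := Finset.mem_add.mp hg1
  rw [Finset.mem_singleton] at ha
  subst ha
  obtain ⟨a', ha', y₁, hy₁, heq⟩ := Finset.mem_add.mp hg2
  have hKI : ∃ x' z', (z', x') ∈ blockPairs Z₁ X₁ Z₂ X₂ ∧ x' - z' = a' := by
    rcases Finset.mem_union.mp ha' with h1 | h2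
    · obtain ⟨x', hx', z', hz', he⟩ := mem_diffImage.mp h1
      exact ⟨x', z', mem_blockPairs.mpr (Or.inl ⟨hz', hx'⟩), he⟩
    · obtain ⟨x', hx', z', hz', he⟩ := mem_diffImage.mp h2
      exact ⟨x', z', mem_blockPairs.mpr (Or.inr ⟨hz', hx'⟩), he⟩
  obtain ⟨x', z', hki, rfl⟩ := hKI
  have h0 : (h - y₁) + (y₂ - z₂) + (z' - x') = 0 :=
    calc (h - y₁) + (y₂ - z₂) + (z' - x') = (h - z₂ + y₂) - (x' - z' + y₁) := by abel
      _ = 0 := by rw [← heq, sub_self]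
  have hc := hN h y₁ y₂ z₂ z' x' (mem_blockPairs.mpr (Or.inl ⟨hh₁, hy₁⟩))
    (mem_blockPairs.mpr (Or.inr ⟨hy₂, hz₂⟩)) hki h0
  exact Finset.disjoint_left.mp hY hy₁ (hc.2.1.symm ▸ hy₂)

/-- THE REDUCTION: if the pure hub statement holds in `G`, then every hub pair (accidental-free union of two complete
blocks with disjoint `J`- and `K`-classes, non-empty `Y`- and `Z`-classes and a common row `h`) has total volume
`|X₁||Y₁||Z₁| + |X₂||Y₂||Z₂| ≤ |G|`. -/
theorem NoAccidental.volume_add_volume_le_card_of_pureHub [Fintype G] (hPH : PureHubStatement G)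
    {h : G} (hh₁ : h ∈ X₁) (hh₂ : h ∈ X₂) (hY : Disjoint Y₁ Y₂) (hZ : Disjoint Z₁ Z₂)
    (hY₁ : Y₁.Nonempty) (hY₂ : Y₂.Nonempty) (hZ₁ : Z₁.Nonempty) (hZ₂ : Z₂.Nonempty)
    (hN : NoAccidental (id : G → G) id id (blockPairs X₁ Y₁ X₂ Y₂) (blockPairs Y₁ Z₁ Y₂ Z₂)
      (blockPairs Z₁ X₁ Z₂ X₂)) :
    X₁.card * Y₁.card * Z₁.card + X₂.card * Y₂.card * Z₂.card ≤ Fintype.card G := by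
  obtain ⟨z₁, hz₁⟩ := hZ₁
  obtain ⟨z₂, hz₂⟩ := hZ₂
  have hN' := hN.swap_blocks
  have key := hPH (diffImage X₁ Z₁) (diffImage X₂ Z₂) Y₁ Y₂ (hN.disjoint_diffImage hY₁ hZ) hY
    (hN.card_diffImage_add hY₁) (hN'.card_diffImage_add hY₂) (hN.disjoint_diffImage_add₁ hZ)
    (hN.disjoint_diffImage_add₂ hZ)
    ⟨h - z₁, mem_diffImage.mpr ⟨h, hh₁, z₁, hz₁, rfl⟩, hN.disjoint_hub_translate₁ hh₂ hz₁ hY⟩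
    ⟨h - z₂, mem_diffImage.mpr ⟨h, hh₂, z₂, hz₂, rfl⟩, hN.disjoint_hub_translate₂ hh₁ hz₂ hY⟩
  rw [hN.card_diffImage hY₁, hN'.card_diffImage hY₂] at key
  calc X₁.card * Y₁.card * Z₁.card + X₂.card * Y₂.card * Z₂.card
        = X₁.card * Z₁.card * Y₁.card + X₂.card * Z₂.card * Y₂.card := by
          rw [Nat.mul_right_comm X₁.card, Nat.mul_right_comm X₂.card]
    _ ≤ ((diffImage X₁ Z₁ ∪ diffImage X₂ Z₂) + (Y₁ ∪ Y₂)).card := key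
    _ ≤ Fintype.card G := Finset.card_le_univ _

/-- THE REDUCTION, triangle form: under the pure hub statement a hub pair spans at most `|G|` triangles, i.e. the
packing bound `T ≤ |G|` conjectured for all hub pairs. -/
theorem NoAccidental.card_triangleSet_le_card_of_pureHub [Fintype G] (hPH : PureHubStatement G)
    {h : G} (hh₁ : h ∈ X₁) (hh₂ : h ∈ X₂) (hY : Disjoint Y₁ Y₂) (hZ : Disjoint Z₁ Z₂)
    (hY₁ : Y₁.Nonempty) (hY₂ : Y₂.Nonempty) (hZ₁ : Z₁.Nonempty) (hZ₂ : Z₂.Nonempty)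
    (hN : NoAccidental (id : G → G) id id (blockPairs X₁ Y₁ X₂ Y₂) (blockPairs Y₁ Z₁ Y₂ Z₂)
      (blockPairs Z₁ X₁ Z₂ X₂)) :
    (triangleSet (blockPairs X₁ Y₁ X₂ Y₂) (blockPairs Y₁ Z₁ Y₂ Z₂) (blockPairs Z₁ X₁ Z₂ X₂)).card ≤
      Fintype.card G := by
  rw [card_triangleSet_blockPairs_of_disjoint hY hZ]
  exact hN.volume_add_volume_le_card_of_pureHub hPH hh₁ hh₂ hY hZ hY₁ hY₂ hZ₁ hZ₂

end PureHub

end Summit.MatrixMultiplication.MatrixMultiplication.Theorems.SoloVal
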